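import Summits.AnomalousDissipation.AnomalousDissipation.Theorems.SawtoothPulseCascadeK1LocalisedCascadeKHSourceResponse
import Summits.AnomalousDissipation.AnomalousDissipation.Theorems.SawtoothPulseCascadeK1LocalisedCascadeKHForcingModes
import Summits.AnomalousDissipation.AnomalousDissipation.Theorems.SawtoothPulseCascadeK1LocalisedCascadeKHComponentAssembly
import Summits.AnomalousDissipation.AnomalousDissipation.Theorems.SawtoothPulseCascadeK1LocalisedCascadeKHCreationNumericCosNegQuarter
import Summits.AnomalousDissipation.AnomalousDissipation.Theorems.SawtoothPulseCascadeK1LocalisedCascadeKHCreationNumericSinQuarter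
import Summits.AnomalousDissipation.AnomalousDissipation.Theorems.SawtoothPulseCascadeK1LocalisedCascadeKHCreationNumericSinNegQuarter

/-!
# K2 lane (route-2 `SawtoothPulseCascade`, crux dir `K1LocalisedCascade`): the SINGLE-MODE STABLE-BLOCK CREATION LAW, importable form — amplitude `≤ 8.5/a`

Helper file of the K2 lane (ACL item stmt-AnomalousDissipation-19491; S2-cert forced part / P1″, A26-4 (a)). The tree-vocabulary packaging of the chain
`…KHForcingClosedForm` → `…KHSourceResponse` (twelve-term bound) → `…KHCreationNumeric*` (≤ 0.163/a², 0.3/a³) → `…KHComponentAssembly`, so that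
Theorems files can import it (the by-name version over p4's `sheetAmps` is the crux workfile `K2StableCreation.lean`, not importable):
* `creation_arith'`: `4πa·0.163/a² + (πa/2)·4πa·0.3/a³ + (40/399)·4πa·0.3/a³ ≤ 8.5/a` (`a ≥ 1`);
* `singleMode_creation_le`: for `a ≥ 1`, `θ ≥ 0`, a rate `ω ∈ [0.55a, πa/2 − 399/401]`, block entries `‖x₀‖ ≤ πa/2`, `‖x₁‖ ≤ 40/399` (resp. swapped for
  component `1`), couplings of size `4πa`, and the single-mode sources `S₀, S₁` at the kink lines `y = ±¼` (the integrals of `…KHForcingClosedForm` with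
  the quasi-periodic kernel `G`), the component `∫₀^θ [cos(ω(θ−s))·cᵢSᵢ + (sin(ω(θ−s))/ω)(x₀c₀S₀ + x₁c₁S₁)]` has norm `≤ 8.5/a`, uniformly in `θ`, `β`, `ξ`.
No definitions; no statement about the crux. [cite: Drazin2002, §8.3 (8.36)–(8.38)] [problem: turb]
-/

-- `Summit.<Summit>.<Problem>`: single-conjunct summit, the duplicate namespace segment is deliberate.
set_option linter.dupNamespace false

noncomputable section

namespace Summit.AnomalousDissipation.AnomalousDissipation.Theorems.SawtoothPulseCascade.K2PhaseBudget

open Set MeasureTheory intervalIntegral Literature.Analysis.FluidPDE.SawtoothCascade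

/-- The final arithmetic: `4πa·(0.163/a²) + (πa/2)·4πa·(0.3/a³) + (40/399)·4πa·(0.3/a³) ≤ 8.5/a` for `a ≥ 1`. [folklore] -/
theorem creation_arith' {a : ℝ} (ha : 1 ≤ a) :
    4 * Real.pi * a * (0.163 / a ^ 2) + Real.pi * a / 2 * (4 * Real.pi * a) * (0.3 / a ^ 3) + 40 / 399 * (4 * Real.pi * a) * (0.3 / a ^ 3) ≤
      8.5 / a := by
  have ha0 : 0 < a := by linarith
  have hπ : Real.pi < 3.1416 := Real.pi_lt_d4
  have hπ0 : 0 < Real.pi := Real.pi_pos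
  have e : 4 * Real.pi * a * (0.163 / a ^ 2) + Real.pi * a / 2 * (4 * Real.pi * a) * (0.3 / a ^ 3) + 40 / 399 * (4 * Real.pi * a) * (0.3 / a ^ 3) =
      (0.652 * Real.pi + 0.6 * Real.pi ^ 2 + (48 * Real.pi / 399) / a) / a := by
    field_simp; ring
  rw [e]
  apply div_le_div_of_nonneg_right _ ha0.le
  have h3 : (48 * Real.pi / 399) / a ≤ 48 * Real.pi / 399 := div_le_self (by positivity) ha
  nlinarith [mul_pos hπ0 hπ0]

section law

variable {a : ℝ} {K G : ℝ → ℂ}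

/-- The single-mode sources are continuous in the strain time (closed form = three continuous pieces). [cite: Drazin2002, §8.3 (8.36)–(8.38)] -/
theorem continuous_singleMode_src (ha : 0 < a) (β ξ : ℝ)
    (hK : K = fun r : ℝ => (-((Real.exp (-(2 * Real.pi * a * r)) : ℂ) /
            (1 - starRingEnd ℂ (Complex.exp (2 * Real.pi * β * Complex.I)) * (Real.exp (-(2 * Real.pi * a)) : ℂ))
          + (Real.exp (2 * Real.pi * a * (r - 1)) : ℂ) * Complex.exp (2 * Real.pi * β * Complex.I) /
            (1 - Complex.exp (2 * Real.pi * β * Complex.I) * (Real.exp (-(2 * Real.pi * a)) : ℂ))) /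
        (2 * (2 * Real.pi * a) : ℂ)))
    (hG : ∀ u : ℝ, G u = Complex.exp (2 * Real.pi * β * (⌊u⌋ : ℝ) * Complex.I) * K (u - ⌊u⌋)) {y₀ : ℝ} (hy₀ : y₀ = 1 / 4 ∨ y₀ = -(1 / 4)) :
    Continuous fun s : ℝ => ∫ y in (-(1 / 2 : ℝ))..(1 / 2 : ℝ), G (y₀ - y) * Complex.exp (((2 * Real.pi * ξ * y : ℝ) : ℂ) * Complex.I) *
      Complex.exp (-((2 * Real.pi * a * s * triWave y : ℝ) : ℂ) * Complex.I) := by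
  have hμ1 : (2 * Real.pi * a : ℝ) ≠ 0 := by positivity
  have hμ2 : (-(2 * Real.pi * a) : ℝ) ≠ 0 := by
    have h2 : (0:ℝ) < 2 * Real.pi * a := by positivity
    linarith
  have hc : ∀ (φ₀ : ℝ) (c₁ c₂ : ℂ) (ν y₁ y₂ : ℝ), Continuous fun s : ℝ =>
      (Complex.exp (((φ₀ * s : ℝ)) * Complex.I) *
        (c₁ * ((Complex.exp ((((((2 * Real.pi * a) : ℝ)) : ℂ) + ((((2 * Real.pi * ξ) + ν * s : ℝ)) : ℂ) * Complex.I) * y₂) -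
            Complex.exp ((((((2 * Real.pi * a) : ℝ)) : ℂ) + ((((2 * Real.pi * ξ) + ν * s : ℝ)) : ℂ) * Complex.I) * y₁)) /
            (((((2 * Real.pi * a) : ℝ)) : ℂ) + ((((2 * Real.pi * ξ) + ν * s : ℝ)) : ℂ) * Complex.I)) +
         c₂ * ((Complex.exp ((((((-(2 * Real.pi * a)) : ℝ)) : ℂ) + ((((2 * Real.pi * ξ) + ν * s : ℝ)) : ℂ) * Complex.I) * y₂) -
            Complex.exp ((((((-(2 * Real.pi * a)) : ℝ)) : ℂ) + ((((2 * Real.pi * ξ) + ν * s : ℝ)) : ℂ) * Complex.I) * y₁)) /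
            (((((-(2 * Real.pi * a)) : ℝ)) : ℂ) + ((((2 * Real.pi * ξ) + ν * s : ℝ)) : ℂ) * Complex.I)))) := by
    intro φ₀ c₁ c₂ ν y₁ y₂
    have d1 : ∀ s : ℝ, ((((2 * Real.pi * a) : ℝ)) : ℂ) + ((((2 * Real.pi * ξ) + ν * s : ℝ)) : ℂ) * Complex.I ≠ 0 :=
      fun s => lorentz_denom_ne_zero hμ1 _
    have d2 : ∀ s : ℝ, ((((-(2 * Real.pi * a)) : ℝ)) : ℂ) + ((((2 * Real.pi * ξ) + ν * s : ℝ)) : ℂ) * Complex.I ≠ 0 :=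
      fun s => lorentz_denom_ne_zero hμ2 _
    refine Continuous.mul (by fun_prop) (Continuous.add ?_ ?_)
    · exact continuous_const.mul (Continuous.div (by fun_prop) (by fun_prop) d1)
    · exact continuous_const.mul (Continuous.div (by fun_prop) (by fun_prop) d2)
  rcases hy₀ with h | h <;> subst h
  · simp_rw [src_quarter_pieces ha β ξ hK hG]
    exact ((hc _ _ _ _ _ _).add (hc _ _ _ _ _ _)).add (hc _ _ _ _ _ _)
  · simp_rw [src_negQuarter_pieces ha β ξ hK hG]
    exact ((hc _ _ _ _ _ _).add (hc _ _ _ _ _ _)).add (hc _ _ _ _ _ _)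

/-- **The single-mode stable-block creation law (importable form).** For `a ≥ 1`, `θ ≥ 0`, a rate `ω` in the window `[0.55a, πa/2 − 399/401]`, block
entries `‖x₀‖ ≤ πa/2`, `‖x₁‖ ≤ 40/399`, and the single-mode sources at `y = ¼` (cosine entry) and `y = ±¼` (sine entries): the created-amplitude component
`∫₀^θ [cos(ω(θ−s))·(2πia(−2))S₀(s) + (sin(ω(θ−s))/ω)·(x₀(2πia(−2))S₀(s) + x₁(2πia·2)S₁(s))] ds` has norm `≤ 8.5/a`. (The other component: swap the roles,
`singleMode_creation_le'`.) [cite: Drazin2002, §8.3 (8.36)–(8.38)] -/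
theorem singleMode_creation_le (ha : 1 ≤ a) (β ξ : ℝ) {θ ω : ℝ} (hθ : 0 ≤ θ) (hlo : 0.55 * a ≤ ω) (hhi : ω ≤ Real.pi * a / 2 - 399 / 401)
    (hK : K = fun r : ℝ => (-((Real.exp (-(2 * Real.pi * a * r)) : ℂ) /
            (1 - starRingEnd ℂ (Complex.exp (2 * Real.pi * β * Complex.I)) * (Real.exp (-(2 * Real.pi * a)) : ℂ))
          + (Real.exp (2 * Real.pi * a * (r - 1)) : ℂ) * Complex.exp (2 * Real.pi * β * Complex.I) /
            (1 - Complex.exp (2 * Real.pi * β * Complex.I) * (Real.exp (-(2 * Real.pi * a)) : ℂ))) /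
        (2 * (2 * Real.pi * a) : ℂ)))
    (hG : ∀ u : ℝ, G u = Complex.exp (2 * Real.pi * β * (⌊u⌋ : ℝ) * Complex.I) * K (u - ⌊u⌋))
    {x₀ x₁ : ℂ} (hx₀ : ‖x₀‖ ≤ Real.pi * a / 2) (hx₁ : ‖x₁‖ ≤ 40 / 399) :
    ‖∫ s in (0 : ℝ)..θ, ((Real.cos (ω * (θ - s)) : ℂ) * ((((2 * Real.pi * a : ℝ) * Complex.I : ℂ) * (-2)) *
          ∫ y in (-(1 / 2 : ℝ))..(1 / 2 : ℝ), G ((1 / 4 : ℝ) - y) * Complex.exp (((2 * Real.pi * ξ * y : ℝ) : ℂ) * Complex.I) *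
            Complex.exp (-((2 * Real.pi * a * s * triWave y : ℝ) : ℂ) * Complex.I)) +
        ((Real.sin (ω * (θ - s)) / ω : ℝ) : ℂ) *
          (x₀ * ((((2 * Real.pi * a : ℝ) * Complex.I : ℂ) * (-2)) *
              ∫ y in (-(1 / 2 : ℝ))..(1 / 2 : ℝ), G ((1 / 4 : ℝ) - y) * Complex.exp (((2 * Real.pi * ξ * y : ℝ) : ℂ) * Complex.I) *
                Complex.exp (-((2 * Real.pi * a * s * triWave y : ℝ) : ℂ) * Complex.I)) +
           x₁ * ((((2 * Real.pi * a : ℝ) * Complex.I : ℂ) * 2) *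
              ∫ y in (-(1 / 2 : ℝ))..(1 / 2 : ℝ), G ((-(1 / 4 : ℝ)) - y) * Complex.exp (((2 * Real.pi * ξ * y : ℝ) : ℂ) * Complex.I) *
                Complex.exp (-((2 * Real.pi * a * s * triWave y : ℝ) : ℂ) * Complex.I))))‖ ≤ 8.5 / a := by
  have ha0 : 0 < a := by linarith
  have hω : ω ≠ 0 := by intro h; linarith
  have hω1 : Real.pi * a / 2 - ω ≠ 0 := by intro h; linarith
  have hω2 : Real.pi * a / 2 + ω ≠ 0 := by
    have : 0 ≤ ω := by linarith
    intro h; linarith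
  have hS0 := continuous_singleMode_src ha0 β ξ hK hG (Or.inl rfl)
  have hS1 := continuous_singleMode_src ha0 β ξ hK hG (Or.inr rfl)
  have Bc := (norm_integral_cos_src_quarter_le ha0 β ξ hθ hω hω1 hω2 hK hG).trans (twelveTerm_cos_quarter_le ha β hlo hhi)
  have Bs0 := (norm_integral_sin_src_quarter_le ha0 β ξ hθ hω hω1 hω2 hK hG).trans (twelveTerm_sin_quarter_le ha β hlo hhi)
  have Bs1 := (norm_integral_sin_src_negQuarter_le ha0 β ξ hθ hω hω1 hω2 hK hG).trans (twelveTerm_sin_negQuarter_le ha β hlo hhi)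
  have h := norm_component_zero_le (kc := fun s => Real.cos (ω * (θ - s))) (ks := fun s => Real.sin (ω * (θ - s)) / ω)
    (by fun_prop) (by fun_prop) hS0 hS1 (((2 * Real.pi * a : ℝ) * Complex.I : ℂ) * (-2)) (((2 * Real.pi * a : ℝ) * Complex.I : ℂ) * 2)
    x₀ x₁ Bc Bs0 Bs1
  have hκ : 0 < 2 * Real.pi * a := by positivity
  have hc0 : ‖(((2 * Real.pi * a : ℝ) * Complex.I : ℂ) * (-2))‖ = 4 * Real.pi * a := by
    rw [norm_mul, norm_mul, Complex.norm_real, Complex.norm_I, Real.norm_eq_abs, abs_of_pos hκ, norm_neg]; simp; ring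
  have hc1 : ‖(((2 * Real.pi * a : ℝ) * Complex.I : ℂ) * 2)‖ = 4 * Real.pi * a := by
    rw [norm_mul, norm_mul, Complex.norm_real, Complex.norm_I, Real.norm_eq_abs, abs_of_pos hκ]; simp; ring
  rw [hc0, hc1] at h
  have hA := creation_arith' ha
  have hκ4 : (0 : ℝ) ≤ 4 * Real.pi * a := by positivity
  have p2 : ‖x₀‖ * (4 * Real.pi * a) * (0.3 / a ^ 3) ≤ Real.pi * a / 2 * (4 * Real.pi * a) * (0.3 / a ^ 3) :=
    mul_le_mul_of_nonneg_right (mul_le_mul_of_nonneg_right hx₀ hκ4) (by positivity)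
  have p3 : ‖x₁‖ * (4 * Real.pi * a) * (0.3 / a ^ 3) ≤ 40 / 399 * (4 * Real.pi * a) * (0.3 / a ^ 3) :=
    mul_le_mul_of_nonneg_right (mul_le_mul_of_nonneg_right hx₁ hκ4) (by positivity)
  linarith

end law

end Summit.AnomalousDissipation.AnomalousDissipation.Theorems.SawtoothPulseCascade.K2PhaseBudget

end
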